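import Literature.AlgebraicGeometry.Deformation.EssentialMorphisms
import Mathlib.LinearAlgebra.Dual.Lemmas
import Mathlib.Algebra.Ring.GeomSum
import HarnessLib

/-!
# [Schlessinger1968, Lemma 1.4 (i), pp. 209–210]: a surjection of `Art_k` is ESSENTIAL iff it induces an
isomorphism of cotangent spaces

Family `hodge` (computation cell `pub-hsemireg`, LIT-W seat «Pridham / derived deformation theory as printed»), layer
`Literature/AlgebraicGeometry/Deformation`. Vocabulary: `EssentialMorphisms.lean` ([Def. 1.3] `ArtAlg.IsEssential`) and
`SmallExtensionFactorization.lean` §7 ([Lemma 1.1] in ideal form, `ArtAlg.surjective_iff_maximalIdeal_le`; locality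
`ArtAlg.map_maximalIdeal_le`).

## Source, verbatim

[Schlessinger1968] M. Schlessinger, *Functors of Artin rings*, Trans. Amer. Math. Soc. 130 (1968) 208–222, p. 209:
«(1.0) `t*_A = 𝔪/(𝔪² + μA)` where `𝔪` is the maximal ideal of `A`.» «Lemma 1.1. A morphism `B → A` in `Ĉ` is surjective
if and only if the induced map from `t*_B` to `t*_A` is surjective.» «Let `p : B → A` be a surjection in `C`. Definition 1.2.
… Definition 1.3. `p` is essential if for any morphism `q : C → B` in `C` such that `pq` is surjective, it follows that
`q` is surjective. From Lemma 1.1 we obtain easily Lemma 1.4. Let `p : B → A` be a surjection in `C`. Then (i) `p` is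
essential if and only if the induced map `p* : t*_B → t*_A` is an isomorphism. …» Proof, p. 210: «(i) If `p*` is an
isomorphism, then by Lemma 1.1, `p` is essential. Conversely let `t̄_1, …, t̄_r` be a basis of `t*_A`, and lift the
`t̄_i` back to elements `t_i` in `B`. Set `C = Λ[t_1, …, t_r] ⊆ B`. Then `p` induces a surjection from `C` to `A`, so if
`p` is essential, `C = B`. But then `dim_k t*_B ≤ r = dim_k t*_A`, so `t*_B ≅ t*_A`.»

## What is typed (`Λ = k`, so `μA = 0` and `t*_A = 𝔪_A/𝔪_A²`)

For a surjection `p : B → A` of `Art_k` the induced `p* : 𝔪_B/𝔪_B² → 𝔪_A/𝔪_A²` is onto (Lemma 1.1), so «`p*` is an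
isomorphism» is its INJECTIVITY, which in ideal form reads: `x ∈ 𝔪_B`, `p x ∈ 𝔪_A²` ⟹ `x ∈ 𝔪_B²` (`hinj`). THIS FILE
proves the «if» half as printed («by Lemma 1.1»): `ArtAlg.isEssential_of_cotangent_injective` — given `q : C → B` with
`p ∘ q` onto, Lemma 1.1 (⇒) for `p ∘ q` gives `𝔪_A ⊆ (pq)(𝔪_C)·A + 𝔪_A²`; pulling back along the surjection `p`
(`𝔪_A = p(𝔪_B)`, `𝔪_A² = p(𝔪_B²)`) every `x ∈ 𝔪_B` is `q`-generated modulo `𝔪_B²` up to an element of `ker p ∩ 𝔪_B`,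
which lies in `𝔪_B²` by `hinj`; Lemma 1.1 (⇐) for `q` finishes. Helper: `ArtAlg.maximalIdeal_le_map_of_surjective`
(`𝔪_A ⊆ p(𝔪_B)` for a surjection of `Art_k`). The «only if» half, `ArtAlg.cotangent_injective_of_isEssential`, is
the printed sub-object argument with the sub-object chosen basis-free (see the section docstring: `k ⊕ V ⊊ B` for an
ideal `V ⊇ 𝔪_B²` missing a kernel element `t ∉ 𝔪_B²`, built as `ArtAlg.scalarsPlusKer` = the object `k ⊕ I` of `Art_k`
for any morphism with kernel `I`, generalising `SmallExtensionFactorization.lean`'s square-zero `ArtAlg.sqZeroKer`);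
both halves: `ArtAlg.isEssential_iff_cotangent_injective`. One DEFINITION with body (`ArtAlg.scalarsPlusKer`) and
THEOREMS; no named fact, no `sorry`. NOT here: (ii), which is `EssentialMorphisms.lean`.

## References

* [Schlessinger1968] M. Schlessinger, Functors of Artin rings, Trans. Amer. Math. Soc. 130 (1968) 208–222: (1.0),
  Lemma 1.1, Def. 1.3, Lemma 1.4 (i), pp. 209–210.
* [StacksProject] The Stacks Project, Tag 06S3 (surjectivity on cotangent spaces).
-/

namespace Literature.AlgebraicGeometry.Deformation

universe u

open IsLocalRing

section EssentialCotangent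

variable {k : Type u} [Field k] {A B : ArtAlg.{u} k}

/-- For a SURJECTION `p : B → A` of `Art_k`, `𝔪_A ⊆ p(𝔪_B)` (a preimage of a non-unit is a non-unit; with
`ArtAlg.map_maximalIdeal_le`, `p(𝔪_B) · A = 𝔪_A`). [cite: Schlessinger1968, Lemma 1.1, p. 209]
[cite: StacksProject, Tag 06S3 (proof: «Choose `x ∈ A` with `f(x) = y` … we see that `x ∈ 𝔪_A`»)] -/
theorem ArtAlg.maximalIdeal_le_map_of_surjective (p : ↥B →ₐ[k] ↥A) (hp : Function.Surjective p) :
    maximalIdeal ↥A ≤ (maximalIdeal ↥B).map p := by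
  intro a ha
  obtain ⟨b, rfl⟩ := hp a
  have hb : b ∈ maximalIdeal ↥B := by
    by_contra hb
    exact ((mem_maximalIdeal _).mp ha) ((not_not.mp (mt (mem_maximalIdeal b).mpr hb)).map p)
  exact Ideal.mem_map_of_mem _ hb

/-- **[Schlessinger1968, Lemma 1.4 (i), «if» half]: «If `p*` is an isomorphism, then by Lemma 1.1, `p` is essential.»**
For a surjection `p : B → A` of `Art_k` whose cotangent map `𝔪_B/𝔪_B² → 𝔪_A/𝔪_A²` is injective — ideal form:
`x ∈ 𝔪_B` and `p x ∈ 𝔪_A²` imply `x ∈ 𝔪_B²` — `p` is essential ([Def. 1.3], `ArtAlg.IsEssential`).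
[cite: Schlessinger1968, Lemma 1.4 (i) with its proof, pp. 209–210, and Lemma 1.1] [cite: StacksProject, Tag 06S3] -/
theorem ArtAlg.isEssential_of_cotangent_injective (p : ↥B →ₐ[k] ↥A) (hp : Function.Surjective p)
    (hinj : ∀ x ∈ maximalIdeal ↥B, p x ∈ maximalIdeal ↥A ^ 2 → x ∈ maximalIdeal ↥B ^ 2) :
    ArtAlg.IsEssential p := by
  intro C q hpq
  -- Lemma 1.1 (⇒) for the surjection `p ∘ q`
  have h1 : maximalIdeal ↥A ≤ (maximalIdeal ↥C).map (p.comp q) ⊔ maximalIdeal ↥A ^ 2 :=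
    (ArtAlg.surjective_iff_maximalIdeal_le (p.comp q)).mp hpq
  -- Lemma 1.1 (⇐) for `q`: it suffices that `𝔪_B ⊆ q(𝔪_C) · B + 𝔪_B²`
  refine (ArtAlg.surjective_iff_maximalIdeal_le q).mpr fun x hx => ?_
  -- `p x ∈ 𝔪_A = (pq)(𝔪_C) · A + 𝔪_A²`; write `p x = p v + p w` with `v ∈ q(𝔪_C) · B`, `w ∈ 𝔪_B²`
  have hpx : p x ∈ (maximalIdeal ↥C).map (p.comp q) ⊔ maximalIdeal ↥A ^ 2 := h1 (ArtAlg.map_maximalIdeal_le p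
    (Ideal.mem_map_of_mem _ hx))
  obtain ⟨z, hz, y, hy, hzy⟩ := Submodule.mem_sup.mp hpx
  -- `(pq)(𝔪_C) · A = p (q(𝔪_C) · B)` and `𝔪_A² ⊆ p(𝔪_B²)` since `p` is surjective
  have hle : (maximalIdeal ↥C).map (p.comp q) ≤ ((maximalIdeal ↥C).map q).map p :=
    Ideal.map_le_iff_le_comap.mpr fun c hc => Ideal.mem_map_of_mem p (Ideal.mem_map_of_mem q hc)
  have hzmap : z ∈ ((maximalIdeal ↥C).map q).map p := hle hz
  obtain ⟨v, hv, rfl⟩ := (Ideal.mem_map_iff_of_surjective _ hp).mp hzmap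
  have hy' : y ∈ (maximalIdeal ↥B ^ 2).map p := by
    rw [Ideal.map_pow]
    exact Ideal.pow_right_mono (ArtAlg.maximalIdeal_le_map_of_surjective p hp) 2 hy
  obtain ⟨w, hw, rfl⟩ := (Ideal.mem_map_iff_of_surjective _ hp).mp hy'
  -- the defect `e = x - v - w` lies in `ker p ∩ 𝔪_B`, hence in `𝔪_B²` by injectivity of `p*`
  have hvB : v ∈ maximalIdeal ↥B := ArtAlg.map_maximalIdeal_le q hv
  have hwB : w ∈ maximalIdeal ↥B := Ideal.pow_le_self two_ne_zero hw
  have he : x - v - w ∈ maximalIdeal ↥B := sub_mem (sub_mem hx hvB) hwB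
  have hpe : p (x - v - w) = 0 := by
    rw [map_sub, map_sub, ← hzy]
    ring
  have he2 : x - v - w ∈ maximalIdeal ↥B ^ 2 := hinj _ he (by rw [hpe]; exact zero_mem _)
  -- so `x = v + (w + e) ∈ q(𝔪_C) · B + 𝔪_B²`
  exact Submodule.mem_sup.mpr ⟨v, hv, w + (x - v - w), add_mem hw he2, by ring⟩

/-! ### «Only if»: an essential surjection has `p*` injective — via the sub-object `k ⊕ V ⊆ B`

Print: «Conversely let `t̄_1, …, t̄_r` be a basis of `t*_A`, and lift the `t̄_i` back to elements `t_i` in `B`. Set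
`C = Λ[t_1, …, t_r] ⊆ B`. Then `p` induces a surjection from `C` to `A`, so if `p` is essential, `C = B`. But then
`dim_k t*_B ≤ r = dim_k t*_A`, so `t*_B ≅ t*_A`.» TYPED without bases: if `t ∈ ker p` is not in `𝔪_B²`, choose a
`k`-linear `f : B → k` killing `𝔪_B²` with `f(t) ≠ 0`; `V = 𝔪_B ∩ ker f` is an ideal with `𝔪_B = V + k t`, and the
sub-object `C = k ⊕ V ⊊ B` of `Art_k` still maps ONTO `A` (`p t = 0`) — so `p` is not essential. The object `k ⊕ I`
for ANY morphism `q` with kernel `I` (`ArtAlg.scalarsPlusKer`, on `SmallExtensionFactorization.lean`'s subalgebra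
`ArtAlg.sqZeroKerSubalgebra q`; units by the geometric series, `I ⊆ 𝔪` being nilpotent) generalises that file's
square-zero `ArtAlg.sqZeroKer`. -/

/-- A unit of `R₁` lying in `k ⊕ I` (`I = ker q`, ANY morphism `q` of `Art_k`) is a unit of `k ⊕ I`:
`(c (1 − n))⁻¹ = c⁻¹ Σ_{j<N} n^j` for `n ∈ I ⊆ 𝔪` nilpotent. (Generalises `ArtAlg.isUnit_sqZeroKer_of_isUnit`, the
square-zero case.) [cite: Schlessinger1968, §1 p. 208 and Lemma 2.10, p. 212] [cite: StacksProject, Tag 06HV] -/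
theorem ArtAlg.isUnit_sqZeroKerSubalgebra_of_isUnit {R₀ R₁ : ArtAlg.{u} k} (q : ↥R₁ →ₐ[k] ↥R₀)
    (x : ArtAlg.sqZeroKerSubalgebra q) (hx : IsUnit (x : ↥R₁)) : IsUnit x := by
  obtain ⟨c, i, hi, hx'⟩ := (ArtAlg.mem_sqZeroKer_iff q (x : ↥R₁)).mp x.2
  have hi𝔪 : i ∈ maximalIdeal ↥R₁ := IsLocalRing.le_maximalIdeal (RingHom.ker_ne_top _) hi
  have hc : c ≠ 0 := by
    rintro rfl
    rw [map_zero, zero_add] at hx'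
    rw [hx'] at hx
    exact (mem_maximalIdeal i).mp hi𝔪 hx
  obtain ⟨N, hN⟩ := ArtAlg.exists_pow_maximalIdeal_eq_bot ↥R₁
  -- `n = −c⁻¹ i ∈ k ⊕ I`, nilpotent
  have hiS : i ∈ ArtAlg.sqZeroKerSubalgebra q := (ArtAlg.mem_sqZeroKer_iff q i).mpr ⟨0, i, hi, by simp⟩
  have hnS : -(algebraMap k ↥R₁ c⁻¹ * i) ∈ ArtAlg.sqZeroKerSubalgebra q :=
    Subalgebra.neg_mem _ (Subalgebra.mul_mem _ (Subalgebra.algebraMap_mem _ _) hiS)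
  have hnN : (-(algebraMap k ↥R₁ c⁻¹ * i)) ^ N = 0 := by
    have hn𝔪 : -(algebraMap k ↥R₁ c⁻¹ * i) ∈ maximalIdeal ↥R₁ := by
      have h := Ideal.mul_mem_left (maximalIdeal ↥R₁) (algebraMap k ↥R₁ c⁻¹) hi𝔪
      exact (maximalIdeal ↥R₁).neg_mem h
    have h := Ideal.pow_mem_pow hn𝔪 N
    rw [hN] at h
    exact (Ideal.mem_bot).mp h
  -- the inverse `y = c⁻¹ Σ n^j ∈ k ⊕ I`
  have hy : algebraMap k ↥R₁ c⁻¹ * ∑ j ∈ Finset.range N, (-(algebraMap k ↥R₁ c⁻¹ * i)) ^ j ∈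
      ArtAlg.sqZeroKerSubalgebra q :=
    Subalgebra.mul_mem _ (Subalgebra.algebraMap_mem _ _)
      (Subalgebra.sum_mem _ fun j _ => Subalgebra.pow_mem _ hnS j)
  have h1 : algebraMap k ↥R₁ c * algebraMap k ↥R₁ c⁻¹ = 1 := by
    rw [← map_mul, mul_inv_cancel₀ hc, map_one]
  have hxy : (x : ↥R₁) * (algebraMap k ↥R₁ c⁻¹ * ∑ j ∈ Finset.range N, (-(algebraMap k ↥R₁ c⁻¹ * i)) ^ j) = 1 := by
    have hx1 : (x : ↥R₁) = algebraMap k ↥R₁ c * (1 - -(algebraMap k ↥R₁ c⁻¹ * i)) := by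
      rw [hx']
      calc algebraMap k ↥R₁ c + i = algebraMap k ↥R₁ c + (algebraMap k ↥R₁ c * algebraMap k ↥R₁ c⁻¹) * i := by
            rw [h1, one_mul]
        _ = algebraMap k ↥R₁ c * (1 - -(algebraMap k ↥R₁ c⁻¹ * i)) := by ring
    calc (x : ↥R₁) * (algebraMap k ↥R₁ c⁻¹ * ∑ j ∈ Finset.range N, (-(algebraMap k ↥R₁ c⁻¹ * i)) ^ j)
        = (algebraMap k ↥R₁ c * algebraMap k ↥R₁ c⁻¹) *
            ((1 - -(algebraMap k ↥R₁ c⁻¹ * i)) * ∑ j ∈ Finset.range N, (-(algebraMap k ↥R₁ c⁻¹ * i)) ^ j) := by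
          rw [hx1]; ring
      _ = 1 := by rw [h1, mul_neg_geom_sum, hnN, sub_zero, one_mul]
  exact IsUnit.of_mul_eq_one (⟨_, hy⟩ : ArtAlg.sqZeroKerSubalgebra q) (Subtype.ext hxy)

/-- `k ⊕ I` is a local ring for ANY morphism `q` with kernel `I`. [cite: StacksProject, Tag 06HV]
[cite: Schlessinger1968, §1 p. 208] -/
theorem ArtAlg.isLocalRing_sqZeroKerSubalgebra {R₀ R₁ : ArtAlg.{u} k} (q : ↥R₁ →ₐ[k] ↥R₀) :
    IsLocalRing (ArtAlg.sqZeroKerSubalgebra q) := by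
  refine IsLocalRing.of_isUnit_or_isUnit_one_sub_self fun x => ?_
  rcases IsLocalRing.isUnit_or_isUnit_one_sub_self (x : ↥R₁) with h | h
  · exact Or.inl (ArtAlg.isUnit_sqZeroKerSubalgebra_of_isUnit q x h)
  · exact Or.inr (ArtAlg.isUnit_sqZeroKerSubalgebra_of_isUnit q (1 - x) h)

/-- **The sub-object `k ⊕ I ⊆ R₁` of `Art_k`** for ANY morphism `q : R₁ → R₀` with kernel `I` (finite-dimensional,
hence Artinian; local by `ArtAlg.isLocalRing_sqZeroKerSubalgebra`; augmentation restricted from `R₁`) — the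
square-zero case is `SmallExtensionFactorization.lean`'s `ArtAlg.sqZeroKer`. Here it plays the printed
`C = Λ[t_1, …, t_r] ⊆ B`. Definition with body. [cite: Schlessinger1968, proof of Lemma 1.4, p. 210]
[cite: StacksProject, Tag 06HV] -/
noncomputable def ArtAlg.scalarsPlusKer {R₀ R₁ : ArtAlg.{u} k} (q : ↥R₁ →ₐ[k] ↥R₀) : ArtAlg.{u} k :=
  haveI : Module.Finite k ↥R₁ := R₁.moduleFinite
  haveI : Module.Finite k (ArtAlg.sqZeroKerSubalgebra q) :=
    Module.Finite.of_injective (ArtAlg.sqZeroKerSubalgebra q).val.toLinearMap Subtype.val_injective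
  haveI : IsArtinianRing (ArtAlg.sqZeroKerSubalgebra q) := IsArtinianRing.of_finite k _
  haveI : IsLocalRing (ArtAlg.sqZeroKerSubalgebra q) := ArtAlg.isLocalRing_sqZeroKerSubalgebra q
  { carrier := ArtAlg.sqZeroKerSubalgebra q
    exists_augmentation := ⟨(Classical.choice R₁.exists_augmentation).comp (ArtAlg.sqZeroKerSubalgebra q).val⟩ }

/-- The carrier of `k ⊕ I ∈ Art_k` is the subalgebra `ArtAlg.sqZeroKerSubalgebra q` (by `rfl`).
[cite: Schlessinger1968, proof of Lemma 1.4, p. 210] -/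
theorem ArtAlg.scalarsPlusKer_carrier {R₀ R₁ : ArtAlg.{u} k} (q : ↥R₁ →ₐ[k] ↥R₀) :
    (ArtAlg.scalarsPlusKer q : Type u) = ↥(ArtAlg.sqZeroKerSubalgebra q) :=
  rfl

/-- Every element of an object `B` of `Art_k` is «scalar + element of `𝔪_B`»: `b − (residue of b) · 1 ∈ 𝔪_B`.
[cite: Schlessinger1968, §1 p. 208 (residue field `k`)] -/
theorem ArtAlg.sub_algebraMap_aug_mem_maximalIdeal (aug : ↥B →ₐ[k] k) (b : ↥B) :
    b - algebraMap k ↥B (aug b) ∈ maximalIdeal ↥B := by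
  rw [← ArtAlg.ker_augmentation_eq_maximalIdeal B aug, RingHom.mem_ker]
  change aug (b - algebraMap k ↥B (aug b)) = 0
  rw [map_sub, AlgHom.commutes, Algebra.algebraMap_self_apply, sub_self]

/-- **[Schlessinger1968, Lemma 1.4 (i), «only if» half]: an ESSENTIAL surjection `p : B → A` of `Art_k` induces an
injective (hence bijective) map of cotangent spaces** — ideal form: `x ∈ 𝔪_B`, `p x ∈ 𝔪_A²` ⟹ `x ∈ 𝔪_B²`. Proof in
the shape of the printed one (a sub-object of `B` mapping onto `A` must be all of `B`): were `t = x − w ∈ ker p`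
(`w ∈ 𝔪_B²`, `p w = p x`) outside `𝔪_B²`, a functional `f` killing `𝔪_B²` with `f t ≠ 0` gives the ideal
`V = 𝔪_B ∩ ker f ⊇ 𝔪_B²` and the proper sub-object `k ⊕ V` (`ArtAlg.scalarsPlusKer` of `B → B/V`) whose inclusion
composed with `p` is still onto (`𝔪_B = V + k t`, `p t = 0`) — contradicting essentiality.
[cite: Schlessinger1968, Lemma 1.4 (i) and its proof, pp. 209–210] -/
theorem ArtAlg.cotangent_injective_of_isEssential (p : ↥B →ₐ[k] ↥A) (hp : Function.Surjective p)
    (hess : ArtAlg.IsEssential p) (x : ↥B) (hx : x ∈ maximalIdeal ↥B) (hpx : p x ∈ maximalIdeal ↥A ^ 2) :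
    x ∈ maximalIdeal ↥B ^ 2 := by
  -- `p x = p w` with `w ∈ 𝔪_B²`; put `t = x − w ∈ ker p`
  have hx2 : p x ∈ (maximalIdeal ↥B ^ 2).map p := by
    rw [Ideal.map_pow]
    exact Ideal.pow_right_mono (ArtAlg.maximalIdeal_le_map_of_surjective p hp) 2 hpx
  obtain ⟨w, hw, hpw⟩ := (Ideal.mem_map_iff_of_surjective _ hp).mp hx2
  suffices ht2 : x - w ∈ maximalIdeal ↥B ^ 2 by
    have := add_mem ht2 hw
    rwa [sub_add_cancel] at this
  by_contra ht
  have htker : p (x - w) = 0 := by rw [map_sub, hpw, sub_self]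
  have ht𝔪 : x - w ∈ maximalIdeal ↥B := sub_mem hx (Ideal.pow_le_self two_ne_zero hw)
  -- a `k`-linear functional killing `𝔪_B²` but not `t`
  have ht' : x - w ∉ (maximalIdeal ↥B ^ 2).restrictScalars k := ht
  obtain ⟨f, hft, hf⟩ := Submodule.exists_dual_map_eq_bot_of_notMem ht' inferInstance
  have hf0 : ∀ m ∈ maximalIdeal ↥B ^ 2, f m = 0 := fun m hm => by
    have h : f m ∈ ((maximalIdeal ↥B ^ 2).restrictScalars k).map f := Submodule.mem_map_of_mem hm
    rw [hf] at h
    exact (Submodule.mem_bot k).mp h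
  obtain ⟨augB⟩ := B.exists_augmentation
  -- the ideal `V = 𝔪_B ∩ ker f`
  let V : Ideal ↥B :=
    { carrier := {v | v ∈ maximalIdeal ↥B ∧ f v = 0}
      add_mem' := fun {a b} ha hb => ⟨add_mem ha.1 hb.1, by rw [map_add, ha.2, hb.2, add_zero]⟩
      zero_mem' := ⟨zero_mem _, map_zero f⟩
      smul_mem' := fun b v hv => by
        refine ⟨Ideal.mul_mem_left _ _ hv.1, ?_⟩
        have hm := ArtAlg.sub_algebraMap_aug_mem_maximalIdeal augB b
        have hsplit : b • v = augB b • v + (b - algebraMap k ↥B (augB b)) * v := by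
          rw [smul_eq_mul, Algebra.smul_def]
          ring
        rw [hsplit, map_add, LinearMap.map_smul, hv.2, smul_zero, zero_add]
        exact hf0 _ (by rw [pow_two]; exact Ideal.mul_mem_mul hm hv.1) }
  have hVle : V ≤ maximalIdeal ↥B := fun v hv => hv.1
  have hVne : V ≠ ⊤ := fun h => (IsLocalRing.maximalIdeal.isMaximal ↥B).ne_top (top_le_iff.mp (h ▸ hVle))
  -- the sub-object `C = k ⊕ V` and its inclusion `ι`
  let qV : ↥B →ₐ[k] ↥(B.ofQuotient V hVne) := Ideal.Quotient.mkₐ k V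
  have hkerV : ∀ v : ↥B, v ∈ RingHom.ker qV ↔ v ∈ V := fun v => by
    rw [RingHom.mem_ker]
    exact Ideal.Quotient.eq_zero_iff_mem
  let C : ArtAlg.{u} k := ArtAlg.scalarsPlusKer qV
  let ι : ↥C →ₐ[k] ↥B := (ArtAlg.sqZeroKerSubalgebra qV).val
  -- `p ∘ ι` is onto: `b = β·1 + m`, `m = v + (f m / f t) t` with `v ∈ V`, and `p t = 0`
  have hsurj : Function.Surjective (p.comp ι) := by
    intro a
    obtain ⟨b, rfl⟩ := hp a
    have hm := ArtAlg.sub_algebraMap_aug_mem_maximalIdeal augB b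
    have hv : b - algebraMap k ↥B (augB b) - (f (b - algebraMap k ↥B (augB b)) / f (x - w)) • (x - w) ∈ V := by
      refine ⟨sub_mem hm (Submodule.smul_of_tower_mem _ _ ht𝔪), ?_⟩
      rw [map_sub, LinearMap.map_smul, smul_eq_mul, div_mul_cancel₀ _ hft, sub_self]
    have hc : algebraMap k ↥B (augB b) +
        (b - algebraMap k ↥B (augB b) - (f (b - algebraMap k ↥B (augB b)) / f (x - w)) • (x - w)) ∈
        ArtAlg.sqZeroKerSubalgebra qV :=
      (ArtAlg.mem_sqZeroKer_iff qV _).mpr ⟨augB b, _, (hkerV _).mpr hv, rfl⟩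
    refine ⟨⟨_, hc⟩, ?_⟩
    change p (algebraMap k ↥B (augB b) +
      (b - algebraMap k ↥B (augB b) - (f (b - algebraMap k ↥B (augB b)) / f (x - w)) • (x - w))) = p b
    have hb : b = algebraMap k ↥B (augB b) +
        (b - algebraMap k ↥B (augB b) - (f (b - algebraMap k ↥B (augB b)) / f (x - w)) • (x - w)) +
        (f (b - algebraMap k ↥B (augB b)) / f (x - w)) • (x - w) := by
      rw [Algebra.smul_def]
      ring
    have hpb : p b = p (algebraMap k ↥B (augB b) +
        (b - algebraMap k ↥B (augB b) - (f (b - algebraMap k ↥B (augB b)) / f (x - w)) • (x - w))) := by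
      conv_lhs => rw [hb]
      rw [map_add, Algebra.smul_def, map_mul, htker, mul_zero, add_zero]
    exact hpb.symm
  -- but `ι` is not onto: `t ∉ k ⊕ V`
  have hnot : ¬ Function.Surjective ι := by
    intro hι
    obtain ⟨c, hc⟩ := hι (x - w)
    have hmem : x - w ∈ ArtAlg.sqZeroKerSubalgebra qV := by rw [← hc]; exact c.2
    obtain ⟨γ, hγ⟩ := hmem
    have hγV : x - w - algebraMap k ↥B γ ∈ V := (hkerV _).mp hγ
    -- residues: `aug t = 0` and `aug` kills `V ⊆ 𝔪_B`, so `γ = 0` and `t ∈ V`, i.e. `f t = 0`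
    have h0 : augB (x - w - algebraMap k ↥B γ) = 0 := by
      have := hVle hγV
      rwa [← ArtAlg.ker_augmentation_eq_maximalIdeal B augB, RingHom.mem_ker] at this
    have ht0 : augB (x - w) = 0 := by
      rw [← ArtAlg.ker_augmentation_eq_maximalIdeal B augB, RingHom.mem_ker] at ht𝔪
      exact ht𝔪
    rw [map_sub, ht0, AlgHom.commutes, Algebra.algebraMap_self_apply, zero_sub, neg_eq_zero] at h0
    rw [h0, map_zero, sub_zero] at hγV
    exact hft hγV.2
  exact hnot (hess ι hsurj)

/-- **[Schlessinger1968, Lemma 1.4 (i)] both halves, ideal form:** for a surjection `p : B → A` of `Art_k`, `p` is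
essential iff `p* : 𝔪_B/𝔪_B² → 𝔪_A/𝔪_A²` is injective (it is always onto, Lemma 1.1), i.e. iff
`∀ x ∈ 𝔪_B, p x ∈ 𝔪_A² → x ∈ 𝔪_B²`. [cite: Schlessinger1968, Lemma 1.4 (i), pp. 209–210] -/
theorem ArtAlg.isEssential_iff_cotangent_injective (p : ↥B →ₐ[k] ↥A) (hp : Function.Surjective p) :
    ArtAlg.IsEssential p ↔ ∀ x ∈ maximalIdeal ↥B, p x ∈ maximalIdeal ↥A ^ 2 → x ∈ maximalIdeal ↥B ^ 2 :=
  ⟨fun h x hx hpx => ArtAlg.cotangent_injective_of_isEssential p hp h x hx hpx,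
    fun h => ArtAlg.isEssential_of_cotangent_injective p hp h⟩

end EssentialCotangent

end Literature.AlgebraicGeometry.Deformation
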